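import Literature.Combinatorics.SetFamily.KatonaIntersectingShadowIterate
import Mathlib.Combinatorics.Enumerative.DoubleCounting
import Mathlib.Data.Finset.Powerset
import HarnessLib

/-!
# One-step scheme: the RELATIVE LYM inequality — combinatorial core (per-fibre counting lemma (PF))

Support file (prover prim-ineq-prove-3 gen 37; `--supports stmt-CriticalPhenomena-4575`; memo
`run/shared/lean/prim/prim-ineq-prove-3/PROOF-G37-VERTEX-COVER-PARTNERS.md` §4.2–4.4).  No definitions, no named facts, no sorries.
`card_filter_le_card_filter_of_downClosed` (PF): for a down-closed family `𝒟` of subsets of `R`, `#R = a + b`, `a < b`, `N ⊆ R`, the `b`-sets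
`Q ∈ 𝒟` with `R ∖ Q ∉ 𝒟` meeting `N` are at most as many as the `a`-sets `P ∈ 𝒟` with `R ∖ P ∉ 𝒟` meeting `N`.  The complements of the former are
an INTERSECTING family of `a`-sets not containing `N` (`card_le_card_meeting_disjoint_of_intersecting`): split off one element of `N` at a time —
members avoiding it: KATONA's intersecting shadow theorem (tree, `Literature.Combinatorics.SetFamily`) in disjointness form
(`card_le_card_disjoint_of_intersecting`); members containing it: degree counting (`card_le_card_disjoint_of_choose_le`, `…_of_small`).
-/

namespace Summit.CriticalPhenomena.PercolationContinuityZ3.Theorems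

namespace SahiOneStep

open Finset
open scoped FinsetFamily

variable {ι : Type*} [DecidableEq ι]

/-! ## Binomial bookkeeping -/
/-- `C(c + d, c)` is non-decreasing in `c`. [folklore] -/
theorem choose_add_le_choose_add {c c' : ℕ} (d : ℕ) (h : c ≤ c') : (c + d).choose c ≤ (c' + d).choose c' := by
  induction h with
  | refl => exact le_rfl
  | step hle ih =>
    rename_i m
    calc (c + d).choose c ≤ (m + d).choose m := ih
      _ ≤ (m + d).choose m + (m + d).choose (m + 1) := Nat.le_add_right _ _
      _ = (m + 1 + d).choose (m + 1) := by rw [show m + 1 + d = (m + d) + 1 by ring, Nat.choose_succ_succ]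

/-! ## Degree counting: `c`-sets versus disjoint `r`-sets -/
/-- **Degree counting.**  If `𝒜` is a family of `c`-subsets of `X`, `r ≤ #X − c`, and `C(#X − r, c) ≤ C(#X − c, r)` (every `r`-set has at most as
many disjoint `c`-sets as a `c`-set has disjoint `r`-sets), then `𝒜` has at most as many members as there are `r`-subsets of `X` disjoint from
some member. [this work] -/
theorem card_le_card_disjoint_of_choose_le (X : Finset ι) (c r : ℕ) (𝒜 : Finset (Finset ι))
    (h𝒜 : ∀ A ∈ 𝒜, A ⊆ X ∧ #A = c) (hr : r ≤ #X - c) (hdeg : (#X - r).choose c ≤ (#X - c).choose r) :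
    #𝒜 ≤ #((X.powersetCard r).filter fun T => ∃ A ∈ 𝒜, Disjoint T A) := by
  set Γ := (X.powersetCard r).filter fun T => ∃ A ∈ 𝒜, Disjoint T A with hΓ
  have hpos : 0 < (#X - c).choose r := Nat.choose_pos hr
  -- double count the disjoint pairs `(A, T)`
  have key : #𝒜 * (#X - c).choose r ≤ #Γ * (#X - r).choose c := by
    refine card_mul_le_card_mul (fun A T => Disjoint T A) (fun A hA => ?_) (fun T hT => ?_)
    · -- every `r`-subset of `X ∖ A` is a neighbour of `A`
      obtain ⟨hAX, hAc⟩ := h𝒜 A hA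
      have hsub : (X \ A).powersetCard r ⊆ Γ.bipartiteAbove (fun A T => Disjoint T A) A := by
        intro T hT
        rw [mem_powersetCard] at hT
        have hdis : Disjoint T A := by
          rw [Finset.disjoint_left]; intro x hx hxA; exact (mem_sdiff.1 (hT.1 hx)).2 hxA
        rw [mem_bipartiteAbove, hΓ, mem_filter, mem_powersetCard]
        exact ⟨⟨⟨hT.1.trans sdiff_subset, hT.2⟩, A, hA, hdis⟩, hdis⟩
      calc (#X - c).choose r = #((X \ A).powersetCard r) := by rw [card_powersetCard, card_sdiff_of_subset hAX, hAc]
        _ ≤ _ := card_le_card hsub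
    · -- the members disjoint from `T` are `c`-subsets of `X ∖ T`
      have hTX : T ⊆ X ∧ #T = r := by
        rw [hΓ, mem_filter, mem_powersetCard] at hT; exact hT.1
      have hsub : 𝒜.bipartiteBelow (fun A T => Disjoint T A) T ⊆ (X \ T).powersetCard c := by
        intro A hA
        rw [mem_bipartiteBelow] at hA
        obtain ⟨hAX, hAc⟩ := h𝒜 A hA.1
        rw [mem_powersetCard]
        refine ⟨fun x hx => mem_sdiff.2 ⟨hAX hx, fun hxT => ?_⟩, hAc⟩
        exact Finset.disjoint_left.1 hA.2 hxT hx
      calc #(𝒜.bipartiteBelow (fun A T => Disjoint T A) T) ≤ #((X \ T).powersetCard c) := card_le_card hsub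
        _ = (#X - r).choose c := by rw [card_powersetCard, card_sdiff_of_subset hTX.1, hTX.2]
  have : #𝒜 * (#X - c).choose r ≤ #Γ * (#X - c).choose r := key.trans (Nat.mul_le_mul_left _ hdeg)
  exact Nat.le_of_mul_le_mul_right this hpos

/-! ## Katona's theorem in complement form -/
/-- **Katona's intersecting shadow theorem, disjointness form.**  An intersecting family `𝒜` of `a`-subsets of `X`, `1 ≤ a`, `2a ≤ #X`, has
at most as many members as there are `(a−1)`-subsets of `X` disjoint from some member: the complements `X ∖ A` form an
`(#X − 2a + 1)`-intersecting family of `(#X − a)`-sets whose `(#X − 2a + 1)`-fold shadow consists of such `(a−1)`-sets.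
[cite: Katona1964, Theorem 1] -/
theorem card_le_card_disjoint_of_intersecting (X : Finset ι) (a : ℕ) (ha : 1 ≤ a) (hX : 2 * a ≤ #X) (𝒜 : Finset (Finset ι))
    (h𝒜 : ∀ A ∈ 𝒜, A ⊆ X ∧ #A = a) (hint : ∀ A ∈ 𝒜, ∀ B ∈ 𝒜, (A ∩ B).Nonempty) :
    #𝒜 ≤ #((X.powersetCard (a - 1)).filter fun T => ∃ A ∈ 𝒜, Disjoint T A) := by
  set s := #X - 2 * a + 1 with hs
  set 𝒞 := 𝒜.image fun A => X \ A with h𝒞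
  have hinj : Set.InjOn (fun A => X \ A) ↑𝒜 := by
    intro A hA B hB hAB
    have hAB' : X \ A = X \ B := hAB
    have h1 : X \ (X \ A) = X \ (X \ B) := by rw [hAB']
    rwa [Finset.sdiff_sdiff_eq_self (h𝒜 A hA).1, Finset.sdiff_sdiff_eq_self (h𝒜 B hB).1] at h1
  have hcard𝒞 : #𝒞 = #𝒜 := card_image_of_injOn hinj
  have hsized : (𝒞 : Set (Finset ι)).Sized (#X - a) := by
    intro C hC
    rw [mem_coe, h𝒞, mem_image] at hC
    obtain ⟨A, hA, rfl⟩ := hC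
    rw [card_sdiff_of_subset (h𝒜 A hA).1, (h𝒜 A hA).2]
  have hI : ∀ C ∈ 𝒞, ∀ C' ∈ 𝒞, s ≤ #(C ∩ C') := by
    intro C hC C' hC'
    rw [h𝒞, mem_image] at hC hC'
    obtain ⟨A, hA, rfl⟩ := hC; obtain ⟨B, hB, rfl⟩ := hC'
    rw [← sdiff_union_distrib, card_sdiff_of_subset (union_subset (h𝒜 A hA).1 (h𝒜 B hB).1)]
    have hAB : #(A ∪ B) ≤ 2 * a - 1 := by
      have h1 := card_union_add_card_inter A B
      rw [(h𝒜 A hA).2, (h𝒜 B hB).2] at h1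
      have h2 : 1 ≤ #(A ∩ B) := card_pos.2 (hint A hA B hB)
      omega
    rw [hs]; omega
  have hK := Literature.Combinatorics.SetFamily.card_le_card_shadow_iterate_of_sized_of_le_card_inter hsized hI
  rw [hcard𝒞] at hK
  refine hK.trans (card_le_card fun T hT => ?_)
  rw [mem_shadow_iterate_iff_exists_sdiff] at hT
  obtain ⟨C, hC, hTC, hCT⟩ := hT
  rw [h𝒞, mem_image] at hC
  obtain ⟨A, hA, rfl⟩ := hC
  rw [mem_filter, mem_powersetCard]
  have hTcard : #T = a - 1 := by
    have h1 : #((X \ A) \ T) + #T = #(X \ A) := card_sdiff_add_card_eq_card hTC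
    rw [hCT, card_sdiff_of_subset (h𝒜 A hA).1, (h𝒜 A hA).2, hs] at h1
    omega
  refine ⟨⟨hTC.trans sdiff_subset, hTcard⟩, A, hA, ?_⟩
  rw [Finset.disjoint_left]
  intro x hx hxA
  exact (mem_sdiff.1 (hTC hx)).2 hxA

/-- Targets through a fixed element: `T ↦ insert f T` injects the `(a−1)`-subsets of `Y ∖ f` disjoint from some member of `𝒜₁` (members of `𝒜`
avoiding `f`) into the `a`-subsets of `Y` containing `f ∈ N` (hence meeting `N`) disjoint from some member of `𝒜`. [this work] -/
theorem card_filter_disjoint_le_card_filter_insert (Y N : Finset ι) {f : ι} (hfY : f ∈ Y) (hfN : f ∈ N) (a : ℕ) (ha : 1 ≤ a)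
    (𝒜₁ 𝒜 : Finset (Finset ι)) (h𝒜₁ : ∀ A ∈ 𝒜₁, A ∈ 𝒜 ∧ f ∉ A) :
    #(((Y.erase f).powersetCard (a - 1)).filter fun T => ∃ A ∈ 𝒜₁, Disjoint T A) ≤
      #(((Y.powersetCard a).filter fun P => (P ∩ N).Nonempty ∧ ∃ A ∈ 𝒜, Disjoint P A).filter fun P => f ∈ P) := by
  refine card_le_card_of_injOn (fun T => insert f T) (fun T hT => ?_) (fun T hT T' hT' hTT' => ?_)
  · rw [mem_coe, mem_filter, mem_powersetCard] at hT
    obtain ⟨⟨hTX, hTc⟩, A, hA, hTA⟩ := hT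
    have hfT : f ∉ T := fun h => by simpa using hTX h
    rw [mem_coe, mem_filter, mem_filter, mem_powersetCard]
    refine ⟨⟨⟨?_, ?_⟩, ⟨f, mem_inter.2 ⟨mem_insert_self _ _, hfN⟩⟩, A, (h𝒜₁ A hA).1, ?_⟩, mem_insert_self _ _⟩
    · exact insert_subset hfY (hTX.trans (erase_subset _ _))
    · rw [card_insert_of_notMem hfT, hTc]; omega
    · rw [Finset.disjoint_insert_left]; exact ⟨(h𝒜₁ A hA).2, hTA⟩
  · rw [mem_coe, mem_filter, mem_powersetCard] at hT hT'
    have hfT : f ∉ T := fun h => by simpa using hT.1.1 h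
    have hfT' : f ∉ T' := fun h => by simpa using hT'.1.1 h
    have := congrArg (fun S => Finset.erase S f) hTT'
    simpa [erase_insert hfT, erase_insert hfT'] using this

/-! ## The recursion along the elements of `N` -/
/-- **Small members (degree counting, recursively).**  `𝒜` a family of `c`-subsets of `Y` with `c + 1 ≤ a ≤ b`, `#Y = b + c`, `N ⊆ Y`, and no
member of `𝒜` containing `N`.  Then `𝒜` has at most as many members as there are `a`-subsets of `Y` meeting `N` and disjoint from some member.
[this work] -/
theorem card_le_card_meeting_disjoint_of_small (a b : ℕ) (hab : a ≤ b) :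
    ∀ (n : ℕ) (Y N : Finset ι) (c : ℕ) (𝒜 : Finset (Finset ι)), #N = n → N ⊆ Y → c + 1 ≤ a → #Y = b + c →
      (∀ A ∈ 𝒜, A ⊆ Y ∧ #A = c) → (∀ A ∈ 𝒜, ¬ N ⊆ A) →
      #𝒜 ≤ #((Y.powersetCard a).filter fun P => (P ∩ N).Nonempty ∧ ∃ A ∈ 𝒜, Disjoint P A) := by
  intro n
  induction n using Nat.strong_induction_on with
  | _ n ih =>
  intro Y N c 𝒜 hn hNY hca hY h𝒜 hNA
  set Γ := (Y.powersetCard a).filter fun P => (P ∩ N).Nonempty ∧ ∃ A ∈ 𝒜, Disjoint P A with hΓ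
  rcases 𝒜.eq_empty_or_nonempty with h𝒜e | ⟨A₀, hA₀⟩
  · rw [h𝒜e, card_empty]; exact Nat.zero_le _
  have hNne : N.Nonempty := nonempty_iff_ne_empty.2 (by rintro rfl; exact hNA A₀ hA₀ (empty_subset _))
  obtain ⟨f, hf⟩ := hNne
  have hfY : f ∈ Y := hNY hf
  set 𝒜₁ := 𝒜.filter fun A => f ∉ A with h𝒜₁
  set 𝒜₂ := 𝒜.filter fun A => f ∈ A with h𝒜₂
  have hsplit : #𝒜 = #𝒜₁ + #𝒜₂ := by
    rw [h𝒜₁, h𝒜₂, add_comm]; exact (card_filter_add_card_filter_not _).symm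
  set Γ₁ := Γ.filter fun P => f ∈ P with hΓ₁
  set Γ₂ := Γ.filter fun P => f ∉ P with hΓ₂
  have hΓsplit : #Γ₁ + #Γ₂ = #Γ := card_filter_add_card_filter_not _
  -- Part 1: members avoiding `f`, targets `insert f T`
  set X := Y.erase f with hX
  have hXcard : #X = b + c - 1 := by rw [hX, card_erase_of_mem hfY, hY]
  have h𝒜₁X : ∀ A ∈ 𝒜₁, A ⊆ X ∧ #A = c := by
    intro A hA
    rw [h𝒜₁, mem_filter] at hA
    refine ⟨fun x hx => mem_erase.2 ⟨?_, (h𝒜 A hA.1).1 hx⟩, (h𝒜 A hA.1).2⟩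
    rintro rfl; exact hA.2 hx
  have h1 : #𝒜₁ ≤ #((X.powersetCard (a - 1)).filter fun T => ∃ A ∈ 𝒜₁, Disjoint T A) := by
    refine card_le_card_disjoint_of_choose_le X c (a - 1) 𝒜₁ h𝒜₁X (by omega) ?_
    have e1 : #X - (a - 1) = c + (b - a) := by omega
    have e2 : #X - c = (a - 1) + (b - a) := by omega
    rw [e1, e2]
    exact choose_add_le_choose_add (b - a) (by omega)
  have h1' : #((X.powersetCard (a - 1)).filter fun T => ∃ A ∈ 𝒜₁, Disjoint T A) ≤ #Γ₁ :=
    card_filter_disjoint_le_card_filter_insert Y N hfY hf a (by omega) 𝒜₁ 𝒜 fun A hA => (mem_filter.1 hA)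
  -- Part 2: members containing `f`, recurse on `N.erase f`
  have h2 : #𝒜₂ ≤ #Γ₂ := by
    rcases Nat.eq_zero_or_pos c with hc0 | hcpos
    · -- no `0`-set contains `f`
      have : 𝒜₂ = ∅ := by
        rw [h𝒜₂, filter_eq_empty_iff]
        intro A hA hfA
        have := (h𝒜 A hA).2
        rw [hc0, card_eq_zero] at this
        rw [this] at hfA; exact notMem_empty f hfA
      rw [this, card_empty]; exact Nat.zero_le _
    set 𝒜₂' := 𝒜₂.image fun A => A.erase f with h𝒜₂'
    have hinj : Set.InjOn (fun A : Finset ι => A.erase f) (𝒜₂ : Set (Finset ι)) := by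
      intro A hA B hB hAB
      rw [mem_coe, h𝒜₂, mem_filter] at hA hB
      have hAB' : A.erase f = B.erase f := hAB
      rw [← insert_erase hA.2, ← insert_erase hB.2, hAB']
    have hcard : #𝒜₂' = #𝒜₂ := card_image_of_injOn hinj
    have hn1 : 1 ≤ n := by rw [← hn]; exact card_pos.2 ⟨f, hf⟩
    have hN' : #(N.erase f) < n := by rw [card_erase_of_mem hf, hn]; omega
    have hIH := ih _ hN' (Y.erase f) (N.erase f) (c - 1) 𝒜₂' rfl (erase_subset_erase f hNY) (by omega)
      (by rw [card_erase_of_mem hfY, hY]; omega) ?_ ?_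
    rotate_left
    · intro A' hA'
      rw [h𝒜₂', mem_image] at hA'
      obtain ⟨A, hA, rfl⟩ := hA'
      rw [h𝒜₂, mem_filter] at hA
      exact ⟨erase_subset_erase f (h𝒜 A hA.1).1, by rw [card_erase_of_mem hA.2, (h𝒜 A hA.1).2]⟩
    · intro A' hA' hNA'
      rw [h𝒜₂', mem_image] at hA'
      obtain ⟨A, hA, rfl⟩ := hA'
      rw [h𝒜₂, mem_filter] at hA
      apply hNA A hA.1
      intro x hx
      by_cases hxf : x = f
      · rw [hxf]; exact hA.2
      · exact mem_of_mem_erase (hNA' (mem_erase.2 ⟨hxf, hx⟩))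
    rw [← hcard]
    refine hIH.trans (card_le_card fun P hP => ?_)
    rw [mem_filter, mem_powersetCard] at hP
    obtain ⟨⟨hPY, hPa⟩, hPN, A', hA', hPA'⟩ := hP
    rw [h𝒜₂', mem_image] at hA'
    obtain ⟨A, hA, rfl⟩ := hA'
    rw [h𝒜₂, mem_filter] at hA
    have hfP : f ∉ P := fun h => by simpa using hPY h
    rw [hΓ₂, mem_filter, hΓ, mem_filter, mem_powersetCard]
    refine ⟨⟨⟨hPY.trans (erase_subset _ _), hPa⟩, ?_, A, hA.1, ?_⟩, hfP⟩
    · obtain ⟨x, hx⟩ := hPN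
      exact ⟨x, mem_inter.2 ⟨(mem_inter.1 hx).1, mem_of_mem_erase (mem_inter.1 hx).2⟩⟩
    · rw [Finset.disjoint_left]
      intro x hxP hxA
      by_cases hxf : x = f
      · exact hfP (hxf ▸ hxP)
      · exact Finset.disjoint_left.1 hPA' hxP (mem_erase.2 ⟨hxf, hxA⟩)
  calc #𝒜 = #𝒜₁ + #𝒜₂ := hsplit
    _ ≤ #Γ₁ + #Γ₂ := Nat.add_le_add (h1.trans h1') h2
    _ = #Γ := hΓsplit

/-- **(PF″) of the memo.**  `#R = a + b`, `1 ≤ a < b`, `N ⊆ R`; `𝒜` an INTERSECTING family of `a`-subsets of `R` none of which contains `N`.  Then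
`𝒜` has at most as many members as there are `a`-subsets of `R` meeting `N` and disjoint from some member (members avoiding a chosen `f ∈ N`:
Katona; members containing `f`: `card_le_card_meeting_disjoint_of_small`). [this work] -/
theorem card_le_card_meeting_disjoint_of_intersecting (R N : Finset ι) (a b : ℕ) (hab : a < b) (hR : #R = a + b) (ha : 1 ≤ a)
    (hNR : N ⊆ R) (𝒜 : Finset (Finset ι)) (h𝒜 : ∀ A ∈ 𝒜, A ⊆ R ∧ #A = a)
    (hint : ∀ A ∈ 𝒜, ∀ B ∈ 𝒜, (A ∩ B).Nonempty) (hNA : ∀ A ∈ 𝒜, ¬ N ⊆ A) :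
    #𝒜 ≤ #((R.powersetCard a).filter fun P => (P ∩ N).Nonempty ∧ ∃ A ∈ 𝒜, Disjoint P A) := by
  set Γ := (R.powersetCard a).filter fun P => (P ∩ N).Nonempty ∧ ∃ A ∈ 𝒜, Disjoint P A with hΓ
  rcases 𝒜.eq_empty_or_nonempty with h𝒜e | ⟨A₀, hA₀⟩
  · rw [h𝒜e, card_empty]; exact Nat.zero_le _
  have hNne : N.Nonempty := nonempty_iff_ne_empty.2 (by rintro rfl; exact hNA A₀ hA₀ (empty_subset _))
  obtain ⟨f, hf⟩ := hNne
  have hfR : f ∈ R := hNR hf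
  set 𝒜₁ := 𝒜.filter fun A => f ∉ A with h𝒜₁
  set 𝒜₂ := 𝒜.filter fun A => f ∈ A with h𝒜₂
  have hsplit : #𝒜 = #𝒜₁ + #𝒜₂ := by
    rw [h𝒜₁, h𝒜₂, add_comm]; exact (card_filter_add_card_filter_not _).symm
  set Γ₁ := Γ.filter fun P => f ∈ P with hΓ₁
  set Γ₂ := Γ.filter fun P => f ∉ P with hΓ₂
  have hΓsplit : #Γ₁ + #Γ₂ = #Γ := card_filter_add_card_filter_not _
  set X := R.erase f with hX
  have hXcard : #X = a + b - 1 := by rw [hX, card_erase_of_mem hfR, hR]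
  -- Part 1: Katona
  have h𝒜₁X : ∀ A ∈ 𝒜₁, A ⊆ X ∧ #A = a := by
    intro A hA
    rw [h𝒜₁, mem_filter] at hA
    refine ⟨fun x hx => mem_erase.2 ⟨?_, (h𝒜 A hA.1).1 hx⟩, (h𝒜 A hA.1).2⟩
    rintro rfl; exact hA.2 hx
  have h1 : #𝒜₁ ≤ #((X.powersetCard (a - 1)).filter fun T => ∃ A ∈ 𝒜₁, Disjoint T A) :=
    card_le_card_disjoint_of_intersecting X a ha (by omega) 𝒜₁ h𝒜₁X
      (fun A hA B hB => hint A (mem_filter.1 hA).1 B (mem_filter.1 hB).1)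
  have h1' : #((X.powersetCard (a - 1)).filter fun T => ∃ A ∈ 𝒜₁, Disjoint T A) ≤ #Γ₁ :=
    card_filter_disjoint_le_card_filter_insert R N hfR hf a ha 𝒜₁ 𝒜 fun A hA => (mem_filter.1 hA)
  -- Part 2: members containing `f` — remove `f` and use the small-member lemma with `c = a - 1`
  have h2 : #𝒜₂ ≤ #Γ₂ := by
    set 𝒜₂' := 𝒜₂.image fun A => A.erase f with h𝒜₂'
    have hinj : Set.InjOn (fun A : Finset ι => A.erase f) (𝒜₂ : Set (Finset ι)) := by
      intro A hA B hB hAB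
      rw [mem_coe, h𝒜₂, mem_filter] at hA hB
      have hAB' : A.erase f = B.erase f := hAB
      rw [← insert_erase hA.2, ← insert_erase hB.2, hAB']
    have hcard : #𝒜₂' = #𝒜₂ := card_image_of_injOn hinj
    have hS := card_le_card_meeting_disjoint_of_small a b hab.le _ (R.erase f) (N.erase f) (a - 1) 𝒜₂' rfl
      (erase_subset_erase f hNR) (by omega) (by rw [card_erase_of_mem hfR, hR]; omega) ?_ ?_
    rotate_left
    · intro A' hA'
      rw [h𝒜₂', mem_image] at hA'
      obtain ⟨A, hA, rfl⟩ := hA'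
      rw [h𝒜₂, mem_filter] at hA
      exact ⟨erase_subset_erase f (h𝒜 A hA.1).1, by rw [card_erase_of_mem hA.2, (h𝒜 A hA.1).2]⟩
    · intro A' hA' hNA'
      rw [h𝒜₂', mem_image] at hA'
      obtain ⟨A, hA, rfl⟩ := hA'
      rw [h𝒜₂, mem_filter] at hA
      apply hNA A hA.1
      intro x hx
      by_cases hxf : x = f
      · rw [hxf]; exact hA.2
      · exact mem_of_mem_erase (hNA' (mem_erase.2 ⟨hxf, hx⟩))
    rw [← hcard]
    refine hS.trans (card_le_card fun P hP => ?_)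
    rw [mem_filter, mem_powersetCard] at hP
    obtain ⟨⟨hPY, hPa⟩, hPN, A', hA', hPA'⟩ := hP
    rw [h𝒜₂', mem_image] at hA'
    obtain ⟨A, hA, rfl⟩ := hA'
    rw [h𝒜₂, mem_filter] at hA
    have hfP : f ∉ P := fun h => by simpa using hPY h
    rw [hΓ₂, mem_filter, hΓ, mem_filter, mem_powersetCard]
    refine ⟨⟨⟨hPY.trans (erase_subset _ _), hPa⟩, ?_, A, hA.1, ?_⟩, hfP⟩
    · obtain ⟨x, hx⟩ := hPN
      exact ⟨x, mem_inter.2 ⟨(mem_inter.1 hx).1, mem_of_mem_erase (mem_inter.1 hx).2⟩⟩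
    · rw [Finset.disjoint_left]
      intro x hxP hxA
      by_cases hxf : x = f
      · exact hfP (hxf ▸ hxP)
      · exact Finset.disjoint_left.1 hPA' hxP (mem_erase.2 ⟨hxf, hxA⟩)
  calc #𝒜 = #𝒜₁ + #𝒜₂ := hsplit
    _ ≤ #Γ₁ + #Γ₂ := Nat.add_le_add (h1.trans h1') h2
    _ = #Γ := hΓsplit

/-! ## The per-fibre counting lemma (PF) -/
/-- **THE PER-FIBRE COUNTING LEMMA (PF).**  Let `𝒟` be a family of subsets of `R` closed under taking subsets, `#R = a + b` with `a < b`, and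
`N ⊆ R`.  Then the `b`-sets `Q ∈ 𝒟` with `R ∖ Q ∉ 𝒟` meeting `N` are at most as numerous as the `a`-sets `P ∈ 𝒟` with `R ∖ P ∉ 𝒟` meeting `N`.
(The complements of the former are an intersecting family of `a`-sets not containing `N`; every `a`-set meeting `N` inside one of the former is
one of the latter.) [this work] -/
theorem card_filter_le_card_filter_of_downClosed (R N : Finset ι) (𝒟 : Finset (Finset ι))
    (hdown : ∀ P ∈ 𝒟, ∀ Q, Q ⊆ P → Q ∈ 𝒟) (a b : ℕ) (hab : a < b) (hR : #R = a + b) (hNR : N ⊆ R) :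
    #((R.powersetCard b).filter fun Q => Q ∈ 𝒟 ∧ R \ Q ∉ 𝒟 ∧ (Q ∩ N).Nonempty) ≤
      #((R.powersetCard a).filter fun P => P ∈ 𝒟 ∧ R \ P ∉ 𝒟 ∧ (P ∩ N).Nonempty) := by
  set 𝒬 := (R.powersetCard b).filter fun Q => Q ∈ 𝒟 ∧ R \ Q ∉ 𝒟 ∧ (Q ∩ N).Nonempty with h𝒬
  set PP := (R.powersetCard a).filter fun P => P ∈ 𝒟 ∧ R \ P ∉ 𝒟 ∧ (P ∩ N).Nonempty with hPP
  rcases Nat.eq_zero_or_pos a with ha0 | hapos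
  · -- `a = 0`: `Q = R` and then `R ∖ Q = ∅ ∈ 𝒟`
    have : 𝒬 = ∅ := by
      rw [h𝒬, filter_eq_empty_iff]
      intro Q hQ hcond
      rw [mem_powersetCard] at hQ
      have hQR : Q = R := eq_of_subset_of_card_le hQ.1 (by rw [hR, hQ.2, ha0, zero_add])
      apply hcond.2.1
      rw [hQR, sdiff_self]
      exact hdown Q hcond.1 ∅ (empty_subset _)
    rw [this, card_empty]; exact Nat.zero_le _
  set 𝒜 := 𝒬.image fun Q => R \ Q with h𝒜
  have h𝒬mem : ∀ Q ∈ 𝒬, (Q ⊆ R ∧ #Q = b) ∧ Q ∈ 𝒟 ∧ R \ Q ∉ 𝒟 ∧ (Q ∩ N).Nonempty := by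
    intro Q hQ; rw [h𝒬, mem_filter, mem_powersetCard] at hQ; exact hQ
  have hinj : Set.InjOn (fun Q => R \ Q) ↑𝒬 := by
    intro Q hQ Q' hQ' hQQ'
    have e : R \ Q = R \ Q' := hQQ'
    have h1 : R \ (R \ Q) = R \ (R \ Q') := by rw [e]
    rwa [Finset.sdiff_sdiff_eq_self (h𝒬mem Q hQ).1.1, Finset.sdiff_sdiff_eq_self (h𝒬mem Q' hQ').1.1] at h1
  have hcard : #𝒜 = #𝒬 := card_image_of_injOn hinj
  have h𝒜R : ∀ A ∈ 𝒜, A ⊆ R ∧ #A = a := by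
    intro A hA
    rw [h𝒜, mem_image] at hA
    obtain ⟨Q, hQ, rfl⟩ := hA
    refine ⟨sdiff_subset, ?_⟩
    rw [card_sdiff_of_subset (h𝒬mem Q hQ).1.1, hR, (h𝒬mem Q hQ).1.2]; omega
  have hint : ∀ A ∈ 𝒜, ∀ B ∈ 𝒜, (A ∩ B).Nonempty := by
    intro A hA B hB
    rw [h𝒜, mem_image] at hA hB
    obtain ⟨Q, hQ, rfl⟩ := hA; obtain ⟨Q', hQ', rfl⟩ := hB
    by_contra hne
    rw [not_nonempty_iff_eq_empty] at hne
    -- then `R ∖ Q ⊆ Q'`, so `R ∖ Q ∈ 𝒟`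
    apply (h𝒬mem Q hQ).2.2.1
    refine hdown Q' (h𝒬mem Q' hQ').2.1 _ fun x hx => ?_
    by_contra hxQ'
    have : x ∈ (R \ Q) ∩ (R \ Q') := mem_inter.2 ⟨hx, mem_sdiff.2 ⟨(mem_sdiff.1 hx).1, hxQ'⟩⟩
    rw [hne] at this; exact notMem_empty x this
  have hNA : ∀ A ∈ 𝒜, ¬ N ⊆ A := by
    intro A hA hNA
    rw [h𝒜, mem_image] at hA
    obtain ⟨Q, hQ, rfl⟩ := hA
    obtain ⟨x, hx⟩ := (h𝒬mem Q hQ).2.2.2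
    exact (mem_sdiff.1 (hNA (mem_inter.1 hx).2)).2 (mem_inter.1 hx).1
  have hmain := card_le_card_meeting_disjoint_of_intersecting R N a b hab hR hapos hNR 𝒜 h𝒜R hint hNA
  rw [hcard] at hmain
  refine hmain.trans (card_le_card fun P hP => ?_)
  rw [mem_filter, mem_powersetCard] at hP
  obtain ⟨⟨hPR, hPa⟩, hPN, A, hA, hPA⟩ := hP
  rw [h𝒜, mem_image] at hA
  obtain ⟨Q, hQ, rfl⟩ := hA
  have hPQ : P ⊆ Q := by
    intro x hx
    by_contra hxQ
    exact Finset.disjoint_left.1 hPA hx (mem_sdiff.2 ⟨hPR hx, hxQ⟩)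
  rw [hPP, mem_filter, mem_powersetCard]
  refine ⟨⟨hPR, hPa⟩, hdown Q (h𝒬mem Q hQ).2.1 P hPQ, fun hRP => ?_, hPN⟩
  exact (h𝒬mem Q hQ).2.2.1 (hdown _ hRP _ (sdiff_subset_sdiff subset_rfl hPQ))

end SahiOneStep

end Summit.CriticalPhenomena.PercolationContinuityZ3.Theorems
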